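import Literature.NumberTheory.Automorphic.GlobalAdditiveCharacter
import Literature.NumberTheory.Automorphic.LocalLanglandsGLProofs
import Literature.NumberTheory.Automorphic.WhittakerCoeffLocalDatum
import Literature.NumberTheory.GaloisRepresentations.HeckeCharacter
import HarnessLib

/-!
# Local components of Hecke characters are smooth characters of `K_vˣ`; the ramification dictionary

Topic `Literature/NumberTheory/Automorphic`; proof file (theorems only: no definition, no named
fact, no instance).  For a Hecke character `ω : 𝕀_K → ℂˣ` (`GaloisRepresentations.HeckeCharacter`)
and a finite place `v`, the local component `ω_v = ω ∘ (K_vˣ ↪ 𝕀_K)`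
(`HeckeCharacter.localComponent`, Tate 1950, §3.2, §4.3) is a CONTINUOUS character of `K_vˣ`
(`HeckeCharacter.continuous_localComponent`: the factor inclusion `u ↦ (…, 1, u, 1, …)` is
continuous, `continuous_localUnits`, because the multiplicative single idele is
`1 + (additive single of u - 1)` and the additive factor inclusion is continuous,
`continuous_finiteAdeleSingleHom`), hence SMOOTH: its kernel is open
(`HeckeCharacter.isOpen_ker_localComponent`, by `isOpen_ker_quasiChar_holds`: no small subgroups in
`ℂˣ`; Bushnell–Henniart 2006, §1.5).  And `ω` is ramified at `v` (`¬ ω.IsUnramifiedAt v`: `ω_v` is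
not trivial on `𝒪_vˣ`, Neukirch VII §6 (6.10)) iff some `u ∈ K_vˣ` of valuation `1` has
`ω_v(u) ≠ 1` (`HeckeCharacter.not_isUnramifiedAt_iff_exists_valuation_eq_one`) — the spelling of
the ramified-twist hypotheses of the local `L`-factor theorems for `GL₂`
(`hasRSLFactor_twist_eq_one_of_spherical`, `GL2LFactorTwistVanishing`).  These are the local inputs
"`ω_u` smooth, `¬ ω.IsUnramifiedAt u ⇒ ω_u|𝒪ˣ ≠ 1`" of clause (R) of the standard `L`-function
theory of cuspidal `GL(2)` (`JacquetLanglands1970_standardLTheoryGL2`).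

## References

* J. Tate, *Fourier analysis in number fields* (1950/1967), §3.2, §4.3. [TateThesis1967]
* J. Neukirch, *Algebraic Number Theory*, Ch. VII §6, (6.10)–(6.11). [NeukirchANT1999]
* C. J. Bushnell, G. Henniart, *The local Langlands conjecture for GL(2)* (2006), §1.5.
  [BushnellHenniart2006]
-/

noncomputable section

open NumberField IsDedekindDomain

namespace Literature.NumberTheory.GaloisRepresentations

variable {K : Type} [Field K] [NumberField K]

/-! ### Continuity of the factor inclusion `K_vˣ → 𝕀_K` -/

/-- The multiplicative single finite adele is `1 +` the additive single of `x - 1`: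
`(…,1,x,1,…) = 1 + (…,0,x-1,0,…)`. [folklore] -/
theorem finiteAdeleSingle_eq_one_add (v : HeightOneSpectrum (𝓞 K)) (x : v.adicCompletion K) :
    finiteAdeleSingle v x = 1 + Automorphic.finiteAdeleSingleHom K v (x - 1) := by
  refine FiniteAdeleRing.ext K fun w => ?_
  change finiteAdeleSingle v x w = (1 : FiniteAdeleRing (𝓞 K) K) w + Automorphic.finiteAdeleSingleHom K v (x - 1) w
  by_cases hw : w = v
  · subst hw
    rw [finiteAdeleSingle_apply_self, Automorphic.finiteAdeleSingleHom_apply_self]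
    change x = 1 + (x - 1)
    ring
  · rw [finiteAdeleSingle_apply_of_ne x hw, Automorphic.finiteAdeleSingleHom_apply_of_ne K v _ hw,
      add_zero]
    rfl

/-- **The multiplicative factor inclusion `K_v → 𝔸_K^∞`, `x ↦ (…, 1, x, 1, …)`, is continuous.**
[folklore] -/
theorem continuous_finiteAdeleSingle (v : HeightOneSpectrum (𝓞 K)) :
    Continuous (finiteAdeleSingle v : v.adicCompletion K → FiniteAdeleRing (𝓞 K) K) := by
  have h : (finiteAdeleSingle v : v.adicCompletion K → FiniteAdeleRing (𝓞 K) K) =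
      fun x => 1 + Automorphic.finiteAdeleSingleHom K v (x - 1) :=
    funext (finiteAdeleSingle_eq_one_add v)
  rw [h]
  exact continuous_const.add
    ((Automorphic.continuous_finiteAdeleSingleHom K v).comp (continuous_id.sub continuous_const))

/-- **The local units embedding `K_vˣ → 𝕀_K` is continuous** (Tate 1950, §3.2: `K_vˣ` is a
topological subgroup of the idele group). [cite: TateThesis1967, §3.2] -/
theorem continuous_localUnits (v : HeightOneSpectrum (𝓞 K)) :
    Continuous (localUnits v : (v.adicCompletion K)ˣ → ideleGroup K) := by
  refine Continuous.units_map _ ?_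
  change Continuous fun x : v.adicCompletion K =>
    (MonoidHom.inr (InfiniteAdeleRing K) (FiniteAdeleRing (𝓞 K) K)) (finiteAdeleSingle v x)
  exact (continuous_const.prodMk continuous_id).comp (continuous_finiteAdeleSingle v)

namespace HeckeCharacter

/-- **Local components of Hecke characters are continuous** (`ω_v = ω ∘ localUnits v`).
[cite: TateThesis1967, §4.3] -/
theorem continuous_localComponent (ω : HeckeCharacter K) (v : HeightOneSpectrum (𝓞 K)) :
    Continuous (ω.localComponent v) :=
  ω.toContinuousMonoidHom.continuous.comp (continuous_localUnits v)

/-- **Local components of Hecke characters are smooth**: `ker ω_v` is open in `K_vˣ` (a continuous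
quasi-character of `K_vˣ` has open kernel — no small subgroups in `ℂˣ`;
`isOpen_ker_quasiChar_holds`). [cite: BushnellHenniart2006, §1.5] -/
theorem isOpen_ker_localComponent (ω : HeckeCharacter K) (v : HeightOneSpectrum (𝓞 K)) :
    IsOpen (((ω.localComponent v).ker : Subgroup (v.adicCompletion K)ˣ) :
      Set (v.adicCompletion K)ˣ) :=
  Automorphic.isOpen_ker_quasiChar_holds (F := v.adicCompletion K)
    (ContinuousMonoidHom.mk (ω.localComponent v) (ω.continuous_localComponent v))

/-! ### The ramification dictionary -/

/-- A unit of `𝒪_v` has valuation `1` in `K_v` (for the `ValuativeRel` valuation of the local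
field `K_v`). [folklore] -/
theorem valuation_units_map_subtype_eq_one (v : HeightOneSpectrum (𝓞 K))
    (u : (v.adicCompletionIntegers K)ˣ) :
    ValuativeRel.valuation (v.adicCompletion K)
      ((Units.map ((v.adicCompletionIntegers K).subtype : _ →* _) u : (v.adicCompletion K)ˣ) :
        v.adicCompletion K) = 1 := by
  rw [(ValuativeRel.isEquiv (ValuativeRel.valuation (v.adicCompletion K))
    (Valued.v : Valuation (v.adicCompletion K) _)).eq_one_iff_eq_one]
  change Valued.v ((u : v.adicCompletionIntegers K) : v.adicCompletion K) = 1
  set a := Valued.v ((u : v.adicCompletionIntegers K) : v.adicCompletion K) with ha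
  set b := Valued.v (((u⁻¹ : (v.adicCompletionIntegers K)ˣ) : v.adicCompletionIntegers K) :
    v.adicCompletion K) with hb
  have h1 : a ≤ 1 := (u : v.adicCompletionIntegers K).2
  have h2 : b ≤ 1 := ((u⁻¹ : (v.adicCompletionIntegers K)ˣ) : v.adicCompletionIntegers K).2
  have hmul : a * b = 1 := by
    rw [ha, hb, ← map_mul, ← Subring.coe_mul, ← Units.val_mul, mul_inv_cancel, Units.val_one,
      Subring.coe_one, map_one]
  refine le_antisymm h1 ?_
  calc (1 : WithZero (Multiplicative ℤ)) = a * b := hmul.symm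
    _ ≤ a := mul_le_of_le_one_right' h2

/-- An element of `K_vˣ` of valuation `1` is (the image of) a unit of `𝒪_v`. [folklore] -/
theorem exists_units_map_subtype_eq_of_valuation_eq_one (v : HeightOneSpectrum (𝓞 K))
    {u : (v.adicCompletion K)ˣ}
    (hu : ValuativeRel.valuation (v.adicCompletion K) (u : v.adicCompletion K) = 1) :
    ∃ u₀ : (v.adicCompletionIntegers K)ˣ,
      Units.map ((v.adicCompletionIntegers K).subtype : _ →* _) u₀ = u := by
  have hequiv := ValuativeRel.isEquiv (ValuativeRel.valuation (v.adicCompletion K))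
    (Valued.v : Valuation (v.adicCompletion K) _)
  have hu' : Valued.v (u : v.adicCompletion K) = 1 := hequiv.eq_one_iff_eq_one.1 hu
  have hmem : (u : v.adicCompletion K) ∈ v.adicCompletionIntegers K :=
    (HeightOneSpectrum.mem_adicCompletionIntegers (R := 𝓞 K) K v).2 hu'.le
  have hmem' : ((u⁻¹ : (v.adicCompletion K)ˣ) : v.adicCompletion K) ∈ v.adicCompletionIntegers K := by
    refine (HeightOneSpectrum.mem_adicCompletionIntegers (R := 𝓞 K) K v).2 (le_of_eq ?_)
    rw [Units.val_inv_eq_inv_val, map_inv₀, hu', inv_one]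
  refine ⟨⟨⟨_, hmem⟩, ⟨_, hmem'⟩, Subtype.ext (by simp), Subtype.ext (by simp)⟩, Units.ext rfl⟩

/-- **The ramification dictionary** (Neukirch VII §6 (6.10); Tate 1950, §2.3): `ω` is ramified at
`v` (`¬ ω.IsUnramifiedAt v`, i.e. `ω_v` is non-trivial on `𝒪_vˣ`) iff there is `u ∈ K_vˣ` of
valuation `1` with `ω_v(u) ≠ 1` — the hypothesis `hram` of the ramified-twist vanishing
`hasRSLFactor_twist_eq_one_of_spherical` (`GL2LFactorTwistVanishing`). [cite: NeukirchANT1999, Ch. VII §6 (6.10)] -/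
theorem not_isUnramifiedAt_iff_exists_valuation_eq_one (ω : HeckeCharacter K)
    (v : HeightOneSpectrum (𝓞 K)) :
    ¬ ω.IsUnramifiedAt v ↔ ∃ u : (v.adicCompletion K)ˣ,
      ValuativeRel.valuation (v.adicCompletion K) (u : v.adicCompletion K) = 1 ∧
        ω.localComponent v u ≠ 1 := by
  constructor
  · intro h
    rw [IsUnramifiedAt] at h
    push Not at h
    obtain ⟨u₀, hu₀⟩ := h
    exact ⟨_, valuation_units_map_subtype_eq_one v u₀, hu₀⟩
  · rintro ⟨u, hu, hne⟩ hunr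
    obtain ⟨u₀, rfl⟩ := exists_units_map_subtype_eq_of_valuation_eq_one v hu
    exact hne (hunr u₀)

/-- Unramified characters are trivial on the elements of valuation `1`. [folklore] -/
theorem IsUnramifiedAt.localComponent_eq_one_of_valuation_eq_one {ω : HeckeCharacter K}
    {v : HeightOneSpectrum (𝓞 K)} (h : ω.IsUnramifiedAt v) {u : (v.adicCompletion K)ˣ}
    (hu : ValuativeRel.valuation (v.adicCompletion K) (u : v.adicCompletion K) = 1) :
    ω.localComponent v u = 1 := by
  by_contra hne
  exact (not_isUnramifiedAt_iff_exists_valuation_eq_one ω v).2 ⟨u, hu, hne⟩ h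

end HeckeCharacter

end Literature.NumberTheory.GaloisRepresentations

end
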